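import Literature.Computability.Cryptography.CryptoFoundationsOneWayFunctions
import Literature.Computability.Cryptography.GoldreichLevinHidingLenProofs
import HarnessLib

/-!
# The Goldreich–Levin theorem (crypto-foundations.S24): discharge of `goldreich_levin`

Sibling proof file of `CryptoFoundationsOneWayFunctions.lean` (D-0014): it proves
`goldreich_levin_holds : goldreich_levin` — for a length-preserving (strong) one-way `f`, the inner
product mod 2 `b(x, r) = ⟨x, r⟩` (`glPred`) is a hard-core predicate of `g(x, r) = (f(x), r)`
(`glFun f`): O. Goldreich, L. A. Levin, STOC 1989; printed as Thm. 2.5.2 of Goldreich's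
*Foundations of Cryptography I* ("Let `f` be an arbitrary strong one-way function, and let `g` be
defined by `g(x, r) = (f(x), r)`, where `|x| = |r|`. Let `b(x, r)` denote the inner product mod 2 of
the binary vectors `x` and `r`. Then the predicate `b` is a hard-core of the function `g`.").

## The proof

The heavy lifting — Rackoff's pairwise-independent list decoding run as a PPT inverter in the
tree's TM2 model — is the tree's Goldreich–Levin theorem for hiding functions with `O(log n)` output
bits, `goldreichLevin_hiding_len_holds` (`GoldreichLevinHidingLenProofs.lean`; Goldreich 2001,
Thm. 2.5.6; Liu–Pass 2020, Appendix). This file reduces the one-bit predictor form to it: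

* `GLHardCore.polyTimeComputable_glPred`: `b` is polynomial time (an `FP` brick program: halve the
  length in unary, split, `andParityFn`).
* The hiding instance: `S₀ = {0,1}ᵐ` (all secrets), no randomness, `g = f`, one block parameter
  (`d = 1`, so `K = ⌊log₂ m⌋` seed blocks). A one-way `f` is `S₀`-hiding
  (`GLHardCore.isHidingOver_of_isOneWay`: recovering `x` itself is harder than finding a preimage),
  hence `{f(x) ‖ σ ‖ GL(x, σ)}` and `{f(x) ‖ σ ‖ U_K}` are computationally indistinguishable.
* The distinguisher `D_par = GLHardCore.dAlg A par` built from a predictor `A` (`par ∈ {0, 1}` is the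
  parity of the simulated Goldreich–Levin level `n = m + (m + par)`; the tree's `glFun`/`glPred`
  split a string of odd length `2m + 1` as `m + (m + 1)` and ignore the last bit of `r`): on
  `⟨1ᵐ, f(x) ‖ σ ‖ u⟩` run `A` on `⟨1ⁿ, f(x) ‖ σ ↾ (m + par)⟩` with `D`'s own coins and output the
  answer XOR `u₀`. Its coin budget hands over exactly `A`'s coin count, which is a function of the
  input length alone (`GLHardCore.Ltot`, `GLHardCore.lvl`); it is PPT by an `FP` program around one
  call of `A` (`GLHardCore.dF`, `GLHardCore.dAlg_isPPT`, the pattern of `LiuPassCondRedProgram.lean`).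
* `GLHardCore.acceptPMF_real` / `acceptPMF_ideal`: for `m ≥ 4`,
  `Pr[D_par(real) = 1] = 1 − Pr[A(1ⁿ, g(U_n)) = b(U_n)]` and `Pr[D_par(ideal) = 1] = 1/2`, so the
  distinguishing advantage at level `m` is `|ε_A(m + (m + par))|` (`distAdvantage_dAlg`).
* Assembly (`goldreich_levin_holds`): a non-negligible `ε_A` is `≥ 1/n^c` in absolute value for
  infinitely many `n` of one parity (`frequently_even_or_odd`), contradicting the negligibility of
  `D_par`'s advantage (`not_frequently_of_indist`).

## References

* O. Goldreich, L. A. Levin, *A hard-core predicate for all one-way functions*, Proc. 21st STOC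
  (1989), 25–32, doi:10.1145/73007.73010.
* O. Goldreich, *Foundations of Cryptography I: Basic Tools*, CUP 2001, Def. 2.5.1, Thm. 2.5.2,
  §2.5.2 (the reduction), Thm. 2.5.6; §3.3.5 (predictors versus distinguishers).
* Y. Liu, R. Pass, *On one-way functions and Kolmogorov complexity*, FOCS 2020 (arXiv:2009.11514),
  Appendix (Goldreich–Levin for `𝒮`-hiding functions).
-/

namespace Literature.Computability.Cryptography

open Finset Filter Asymptotics _root_.Computability Complexity Complexity.Brick Complexity.Plumb
  Complexity.OracleCompose Complexity.HashBricks Polynomial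

namespace GLHardCore

/-! ### `glPred` is polynomial-time computable -/

/-- `halfU w = 1^{⌊|w|/2⌋}` (unary division of the length by the constant `2`). [folklore] -/
noncomputable def halfU : List Bool → List Bool := fstF ∘ divModFn ∘ fanoutFn (fun _ => ones 2) onesFn

/-- Value of `halfU`. [folklore] -/
@[simp] theorem halfU_apply (w : List Bool) : halfU w = ones (w.length / 2) := by
  rw [halfU, Function.comp_apply, Function.comp_apply, fanoutFn_apply, CondRed.onesFn_eq_ones,
    divModFn_boolPair, fstF_boolPair]

/-- `halfU ∈ FP`. [folklore] -/
theorem halfU_mem_FP : halfU ∈ FP :=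
  comp_mem_FP fstF_mem_FP (comp_mem_FP divModFn_mem_FP (fanoutFn_mem_FP (const_mem_FP _) onesFn_mem_FP))

/-- The Goldreich–Levin predicate as a one-bit string function: split `z` at `⌊|z|/2⌋` and take
the parity of the bitwise `AND` of the two halves. [Goldreich 2001, Thm. 2.5.2] [folklore] -/
noncomputable def glPredF : List Bool → List Bool :=
  andParityFn ∘ fanoutFn (takeFn ∘ fanoutFn halfU id) (dropFn ∘ fanoutFn halfU id)

/-- `glPred z` is the inner product of the two halves of `z`. [folklore] -/
theorem glPred_eq_ipBit (z : List Bool) : glPred z = ipBit (z.take (z.length / 2)) (z.drop (z.length / 2)) := rfl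

/-- `glPredF z = [glPred z]`. [folklore] -/
@[simp] theorem glPredF_apply (z : List Bool) : glPredF z = [glPred z] := by
  rw [glPred_eq_ipBit, ipBit_eq_decide_odd]
  simp only [glPredF, Function.comp_apply, fanoutFn_apply, halfU_apply, id, takeFn_boolPair,
    dropFn_boolPair, List.length_replicate, andParityFn_boolPair]

/-- `glPredF ∈ FP`. [folklore] -/
theorem glPredF_mem_FP : glPredF ∈ FP :=
  comp_mem_FP andParityFn_mem_FP (fanoutFn_mem_FP
    (comp_mem_FP takeFn_mem_FP (fanoutFn_mem_FP halfU_mem_FP OracleCompose.id_mem_FP))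
    (comp_mem_FP dropFn_mem_FP (fanoutFn_mem_FP halfU_mem_FP OracleCompose.id_mem_FP)))

/-- **The Goldreich–Levin predicate is polynomial-time computable.** [Goldreich 2001, Thm. 2.5.2] [folklore] -/
theorem polyTimeComputable_glPred : PolyTimeComputable id encodeBool glPred := by
  obtain ⟨p, M, hM⟩ := glPredF_mem_FP
  refine ⟨p, M, fun z => ?_⟩
  have h := hM z
  simp only [id, glPredF_apply] at h
  exact h

/-! ### The distinguisher built from a predictor -/

/-- The Goldreich–Levin level `n = m + (m + par)` simulated at hiding level `m` (`par ∈ {0, 1}`: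
even / odd `n`). [folklore] -/
def nn (par m : ℕ) : ℕ := m + (m + par)

variable (A : RandAlg (List Bool) Bool) (par : ℕ)

/-- **The run function of the distinguisher `D_par`** on input `w = ⟨1ᵐ, s⟩`,
`s = f(x) ‖ σ ‖ u` (`|σ| = ⌊log₂ m⌋·m`), with coins `c`: run the predictor `A` on
`⟨1ⁿ, s ↾ n⟩`, `n = m + (m + par)` (i.e. on `(f(x), r)` with `r` the first `m + par` bits of `σ`),
and output its answer XOR the bit `u₀ = s_{m + ⌊log₂ m⌋ m}`. [Goldreich 2001, §2.5.2 (proof of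
Thm. 2.5.2, reduction to a predictor); §3.3.5 (predictor versus distinguisher)] [folklore] -/
def dRun (w c : List Bool) : Bool :=
  xor (A.run (boolPair (unaryEncodeNat (nn par (boolUnpair w).1.length))
      ((boolUnpair w).2.take (nn par (boolUnpair w).1.length))) c)
    (((boolUnpair w).2.drop ((boolUnpair w).1.length + Nat.log 2 (boolUnpair w).1.length * (boolUnpair w).1.length)).headD false)

/-- The input length `|⟨1ᵐ, s⟩| = 2m + 2 + (m + ⌊log₂ m⌋ m + ⌊log₂ m⌋)` of the distinguisher at
hiding level `m`. [folklore] -/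
def Ltot (m : ℕ) : ℕ := 2 * m + 2 + (m + Nat.log 2 m * m + Nat.log 2 m)

/-- `Ltot` is strictly increasing. [folklore] -/
theorem Ltot_strictMono : StrictMono Ltot := by
  refine strictMono_nat_of_lt_succ fun m => ?_
  unfold Ltot
  have h1 : Nat.log 2 m ≤ Nat.log 2 (m + 1) := Nat.log_mono_right (Nat.le_succ m)
  have h2 : Nat.log 2 m * m ≤ Nat.log 2 (m + 1) * (m + 1) := Nat.mul_le_mul h1 (Nat.le_succ m)
  omega

/-- `m ≤ Ltot m`. [folklore] -/
theorem le_Ltot (m : ℕ) : m ≤ Ltot m := by unfold Ltot; omega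

open Classical in
/-- The hiding level of an input length (`0` off the range of `Ltot`). [folklore] -/
noncomputable def lvl (L : ℕ) : ℕ := if h : ∃ m, Ltot m = L then h.choose else 0

/-- `lvl (Ltot m) = m`. [folklore] -/
theorem lvl_Ltot (m : ℕ) : lvl (Ltot m) = m := by
  have h : ∃ m', Ltot m' = Ltot m := ⟨m, rfl⟩
  rw [lvl, dif_pos h]
  exact Ltot_strictMono.injective h.choose_spec

/-- `lvl L ≤ L`. [folklore] -/
theorem lvl_le (L : ℕ) : lvl L ≤ L := by
  unfold lvl
  split_ifs with h
  · calc h.choose ≤ Ltot h.choose := le_Ltot _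
      _ = L := h.choose_spec
  · exact Nat.zero_le _

/-- **The coin budget of `D_par`**: the predictor's coin count on its inputs of length
`3n + 2`, `n = m + (m + par)`, at the level `m` of the input length. [folklore] -/
noncomputable def dCoin (L : ℕ) : ℕ := A.coinLen (3 * nn par (lvl L) + 2)

/-- **The distinguisher `D_par`** (run function `dRun`, coin budget `dCoin`). [folklore] -/
noncomputable def dAlg : RandAlg (List Bool) Bool where
  run := dRun A par
  coinLen := dCoin A par

/-! ### `D_par` is probabilistic polynomial time: the `FP` program -/

/-- `1ᵐ` from `z = ⟨⟨1ᵐ, s⟩, c⟩`. [folklore] -/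
noncomputable def uM : List Bool → List Bool := onesFn ∘ fstF ∘ fstF
/-- The sample `s`. [folklore] -/
def sF : List Bool → List Bool := sndF ∘ fstF
/-- `1ⁿ`, `n = m + (m + par)`. [folklore] -/
noncomputable def nU : List Bool → List Bool := concatFn ∘ fanoutFn uM (concatFn ∘ fanoutFn uM (fun _ => ones par))
/-- The predictor's input `⟨1ⁿ, s ↾ n⟩`. [folklore] -/
noncomputable def aIn : List Bool → List Bool := fanoutFn (nU par) (takeFn ∘ fanoutFn (nU par) sF)
/-- The predictor's answer `[A(⟨1ⁿ, s ↾ n⟩; c)]`. [folklore] -/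
noncomputable def aBit : List Bool → List Bool := CondRed.dStr A ∘ fanoutFn (aIn par) sndF
/-- `1^{m + ⌊log₂ m⌋ m}`. [folklore] -/
noncomputable def kmU : List Bool → List Bool := concatFn ∘ fanoutFn uM (umulFn ∘ fanoutFn (CondRed.logU ∘ uM) uM)
/-- The bit `[u₀]`, `u₀ = s_{m + ⌊log₂ m⌋ m}`. [folklore] -/
noncomputable def uBit : List Bool → List Bool := headBitFn ∘ dropFn ∘ fanoutFn kmU sF
/-- **`D_par` as a string function on `⟨w, c⟩`.** [folklore] -/
noncomputable def dF : List Bool → List Bool := xorFn (aBit A par) uBit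

variable {A par}

/-- Value of `uM` on `⟨w, c⟩`. [folklore] -/
theorem uM_boolPair (w c : List Bool) : uM (boolPair w c) = ones (boolUnpair w).1.length := by
  simp [uM, fstF, CondRed.onesFn_eq_ones]

/-- Value of `sF` on `⟨w, c⟩`. [folklore] -/
theorem sF_boolPair (w c : List Bool) : sF (boolPair w c) = (boolUnpair w).2 := by
  simp [sF, fstF, sndF]

/-- Value of `nU` on `⟨w, c⟩`. [folklore] -/
theorem nU_boolPair (w c : List Bool) : nU par (boolPair w c) = ones (nn par (boolUnpair w).1.length) := by
  simp only [nU, Function.comp_apply, fanoutFn_apply, uM_boolPair, concatFn_boolPair, Com.ones_append, nn]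

/-- Value of `aIn` on `⟨w, c⟩`: the predictor's input. [folklore] -/
theorem aIn_boolPair (w c : List Bool) : aIn par (boolPair w c) =
    boolPair (ones (nn par (boolUnpair w).1.length)) ((boolUnpair w).2.take (nn par (boolUnpair w).1.length)) := by
  simp only [aIn, Function.comp_apply, fanoutFn_apply, nU_boolPair, sF_boolPair, takeFn_boolPair, List.length_replicate]

/-- Value of `aBit` on `⟨w, c⟩`: the predictor's answer. [folklore] -/
theorem aBit_boolPair (w c : List Bool) : aBit A par (boolPair w c) =
    [A.run (boolPair (ones (nn par (boolUnpair w).1.length)) ((boolUnpair w).2.take (nn par (boolUnpair w).1.length))) c] := by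
  simp only [aBit, Function.comp_apply, fanoutFn_apply, aIn_boolPair, sndF_boolPair, CondRed.dStr, boolUnpair_boolPair]
  rfl

/-- Value of `kmU` on `⟨w, c⟩`. [folklore] -/
theorem kmU_boolPair (w c : List Bool) : kmU (boolPair w c) =
    ones ((boolUnpair w).1.length + Nat.log 2 (boolUnpair w).1.length * (boolUnpair w).1.length) := by
  simp only [kmU, Function.comp_apply, fanoutFn_apply, uM_boolPair, CondRed.logU_apply, List.length_replicate,
    umulFn_boolPair, concatFn_boolPair, Com.ones_append]

/-- Value of `uBit` on `⟨w, c⟩`: the first Goldreich–Levin / fresh bit of the sample. [folklore] -/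
theorem uBit_boolPair (w c : List Bool) : uBit (boolPair w c) =
    [(((boolUnpair w).2.drop ((boolUnpair w).1.length + Nat.log 2 (boolUnpair w).1.length * (boolUnpair w).1.length)).headD false)] := by
  simp only [uBit, Function.comp_apply, fanoutFn_apply, kmU_boolPair, sF_boolPair, dropFn_boolPair, List.length_replicate,
    headBitFn_apply]

/-- **The program computes `D_par`.** [folklore] -/
theorem dF_boolPair (w c : List Bool) : dF A par (boolPair w c) = [dRun A par w c] := by
  rw [dF, xorFn_apply (aBit_boolPair w c) (uBit_boolPair w c), dRun, CondRed.unaryEncodeNat_eq_ones]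

/-- `dF ∈ FP` when the predictor is (as the string function `dStr A`). [folklore] -/
theorem dF_mem_FP (hA : CondRed.dStr A ∈ FP) : dF A par ∈ FP := by
  have huM : uM ∈ FP := comp_mem_FP onesFn_mem_FP (comp_mem_FP fstF_mem_FP fstF_mem_FP)
  have hsF : sF ∈ FP := comp_mem_FP sndF_mem_FP fstF_mem_FP
  have hnU : nU par ∈ FP := comp_mem_FP concatFn_mem_FP (fanoutFn_mem_FP huM
    (comp_mem_FP concatFn_mem_FP (fanoutFn_mem_FP huM (const_mem_FP _))))
  have haIn : aIn par ∈ FP := fanoutFn_mem_FP hnU (comp_mem_FP takeFn_mem_FP (fanoutFn_mem_FP hnU hsF))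
  have haBit : aBit A par ∈ FP := comp_mem_FP hA (fanoutFn_mem_FP haIn sndF_mem_FP)
  have hkmU : kmU ∈ FP := comp_mem_FP concatFn_mem_FP (fanoutFn_mem_FP huM
    (comp_mem_FP umulFn_mem_FP (fanoutFn_mem_FP (comp_mem_FP CondRed.logU_mem_FP huM) huM)))
  have huBit : uBit ∈ FP := comp_mem_FP headBitFn_mem_FP (comp_mem_FP dropFn_mem_FP (fanoutFn_mem_FP hkmU hsF))
  exact xorFn_mem_FP haBit huBit

/-- **`D_par` is PPT** for a PPT predictor `A`. [folklore] -/
theorem dAlg_isPPT (hA : IsPPT A encodeBool) : IsPPT (dAlg A par) encodeBool := by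
  refine ⟨?_, ?_⟩
  · have h1 : PolyTimeComputable (fun p : List Bool × List Bool => boolPair p.1 p.2) encodeBool
        (fun p : List Bool × List Bool => A.run p.1 p.2) := by
      obtain ⟨p, M, hM⟩ := hA.1
      exact ⟨p, M, fun a => hM a⟩
    have hd : CondRed.dStr A ∈ FP := PolyTimeComputable.comp_holds h1 polyTimeComputable_boolUnpair
    obtain ⟨p, M, hM⟩ := dF_mem_FP (A := A) (par := par) hd
    refine ⟨p, M, fun q => ?_⟩
    have hrun := hM (boolPair q.1 q.2)
    simp only [id_eq] at hrun
    rw [dF_boolPair] at hrun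
    exact hrun
  · obtain ⟨q, hq⟩ := hA.2
    refine ⟨q.comp (C 6 * X + C (3 * par + 2)), fun L => ?_⟩
    have hl := lvl_le L
    have h1 : 3 * nn par (lvl L) + 2 ≤ 6 * L + (3 * par + 2) := by unfold nn; omega
    calc (dAlg A par).coinLen L = A.coinLen (3 * nn par (lvl L) + 2) := rfl
      _ ≤ q.eval (3 * nn par (lvl L) + 2) := hq _
      _ ≤ q.eval (6 * L + (3 * par + 2)) := TM2Iter.eval_mono q h1
      _ = (q.comp (C 6 * X + C (3 * par + 2))).eval L := by simp [eval_comp]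



/-! ### Acceptance probabilities of `D_par` -/

/-- All secrets: `S_m = {0,1}ᵐ`. [folklore] -/
def S₀ : ∀ n : ℕ, Finset (List.Vector Bool n) := fun _ => Finset.univ

/-- `S_m ≠ ∅`. [folklore] -/
theorem S₀_nonempty (n : ℕ) : (S₀ n).Nonempty := ⟨⟨List.replicate n false, by simp⟩, Finset.mem_univ _⟩

/-- `|S_m| = 2ᵐ`. [folklore] -/
theorem card_S₀ (n : ℕ) : (S₀ n).card = 2 ^ n := by simp [S₀, card_vector]

/-- `xor a u = 1 ↔ a ≠ u`. [folklore] -/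
theorem xor_eq_true_iff_ne (a u : Bool) : (xor a u = true) ↔ ¬ (a = u) := by
  cases a <;> cases u <;> decide

/-- A singleton-event probability as a count of coin strings. [folklore] -/
theorem pr_singleton_eq_card (B : RandAlg (List Bool) Bool) (z : List Bool) (b : Bool) {κ : ℕ}
    (hκ : B.coinLen z.length = κ) :
    B.pr id z {b} = ((univ.filter fun c : List.Vector Bool κ => B.run z c.toList = b).card : ℝ) / 2 ^ κ := by
  rw [B.pr_eq_card_filter_div id z {b} hκ]
  simp only [Set.mem_singleton_iff]

/-- `Pr[B(z) = 1] + Pr[B(z) = 0] = 1`. [folklore] -/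
theorem pr_true_add_pr_false (B : RandAlg (List Bool) Bool) (z : List Bool) :
    B.pr id z {true} + B.pr id z {false} = 1 := by
  rw [pr_singleton_eq_card B z true rfl, pr_singleton_eq_card B z false rfl, ← add_div,
    div_eq_one_iff_eq (by positivity)]
  have hfilter : (univ.filter fun c : List.Vector Bool (B.coinLen z.length) => B.run z c.toList = false) =
      univ.filter fun c : List.Vector Bool (B.coinLen z.length) => ¬ (B.run z c.toList = true) :=
    Finset.filter_congr fun c _ => Bool.eq_false_iff
  rw [hfilter]
  have h := Finset.card_filter_add_card_filter_not (s := (Finset.univ : Finset (List.Vector Bool (B.coinLen z.length))))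
    (fun c : List.Vector Bool (B.coinLen z.length) => B.run z c.toList = true)
  rw [Finset.card_univ, card_vector, Fintype.card_bool] at h
  exact_mod_cast h

/-- **Pointwise acceptance probability of `D_par`**: if on input `w` the distinguisher runs the
predictor on `ain` and XORs its answer with `u₀`, with matching coin counts, then
`Pr[D_par(w) = 1] = 1 − Pr[A(ain) = u₀]`. [Goldreich 2001, §3.3.5 (predictors versus
distinguishers)] [folklore] -/
theorem pr_dAlg_true {w ain : List Bool} {u₀ : Bool}
    (hrun : ∀ c, (dAlg A par).run w c = xor (A.run ain c) u₀)
    (hcoin : (dAlg A par).coinLen w.length = A.coinLen ain.length) :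
    (dAlg A par).pr id w {true} = 1 - A.pr id ain {u₀} := by
  rw [GLEns.pr_true_eq_card w hcoin, pr_singleton_eq_card A ain u₀ rfl, eq_sub_iff_add_eq, ← add_div,
    div_eq_one_iff_eq (by positivity)]
  have hfilter : (univ.filter fun c : List.Vector Bool (A.coinLen ain.length) => (dAlg A par).run w c.toList = true) =
      univ.filter fun c : List.Vector Bool (A.coinLen ain.length) => ¬ (A.run ain c.toList = u₀) :=
    Finset.filter_congr fun c _ => by rw [hrun, xor_eq_true_iff_ne]
  rw [hfilter, add_comm]
  have h := Finset.card_filter_add_card_filter_not (s := (Finset.univ : Finset (List.Vector Bool (A.coinLen ain.length))))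
    (fun c : List.Vector Bool (A.coinLen ain.length) => A.run ain c.toList = u₀)
  rw [Finset.card_univ, card_vector, Fintype.card_bool] at h
  exact_mod_cast h

/-- A sum over `{0,1}ᵇ` of a function of the first `a ≤ b` bits. [folklore] -/
theorem sum_vector_take {a b : ℕ} (h : a ≤ b) (F : List Bool → ℝ) :
    ∑ τ : List.Vector Bool b, F (τ.toList.take a) = 2 ^ (b - a) * ∑ r : List.Vector Bool a, F r.toList := by
  obtain ⟨d, rfl⟩ := Nat.exists_eq_add_of_le h
  rw [Nat.add_sub_cancel_left]
  have hs := sum_vector_add (M := ℝ) a d (fun u _ => F u)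
  rw [hs]
  simp only [Finset.sum_const, Finset.card_univ, card_vector, Fintype.card_bool, nsmul_eq_mul, Nat.cast_pow,
    Nat.cast_ofNat, Finset.mul_sum]

/-- Transport of a sum over `{0,1}ᵃ` along `a = b`. [folklore] -/
theorem sum_vector_cast {M : Type*} [AddCommMonoid M] {a b : ℕ} (h : a = b) (F : List Bool → M) :
    ∑ v : List.Vector Bool a, F v.toList = ∑ v : List.Vector Bool b, F v.toList := by
  subst h; rfl

/-- `{0,1}¹ ≃ {0,1}`. [folklore] -/
def vecOneEquiv : List.Vector Bool 1 ≃ Bool where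
  toFun v := v.head
  invFun b := b ::ᵥ List.Vector.nil
  left_inv v := by
    calc v.head ::ᵥ List.Vector.nil = v.head ::ᵥ v.tail := by rw [List.Vector.eq_nil v.tail]
      _ = v := List.Vector.cons_head_tail v
  right_inv b := rfl

/-- A sum over `{0,1}¹` of a function of the bit. [folklore] -/
theorem sum_vector_one (g : Bool → ℝ) : ∑ u : List.Vector Bool 1, g (u.toList.headD false) = g true + g false := by
  rw [← Fintype.sum_bool]
  exact Fintype.sum_equiv vecOneEquiv _ _ fun u => by rw [GLInv.headD_toList_one]; rfl

/-- `(l ↾ 1).headD d = l.headD d`. [folklore] -/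
theorem headD_take_one (l : List Bool) (d : Bool) : (l.take 1).headD d = l.headD d := by
  cases l <;> rfl

/-- `⟨x, r⟩` only reads `|x|` bits of `r`. [folklore] -/
theorem ipBit_take_length : ∀ (x r : List Bool), ipBit x (r.take x.length) = ipBit x r
  | [], r => by simp
  | b :: x, [] => by simp
  | b :: x, e :: r => by
    rw [List.length_cons, List.take_succ_cons, ipBit_cons_cons, ipBit_cons_cons, ipBit_take_length x r]

/-- The head of the Goldreich–Levin bits is `⟨x, σ₀⟩`. [folklore] -/
theorem headD_glBits {K m : ℕ} (hK : 1 ≤ K) (x σ : List Bool) : (glBits K m x σ).headD false = ipBit x (σ.take m) := by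
  obtain ⟨K', rfl⟩ := Nat.exists_eq_add_of_le' hK
  simp [glBits, List.range_succ_eq_map]

/-- **The predictor's success probability** `Pr[A(1ⁿ, g(U_n)) = b(U_n)]` at GL level `n`. [folklore] -/
noncomputable def predProb (f : List Bool → List Bool) (A : RandAlg (List Bool) Bool) (n : ℕ) : ℝ :=
  uniformAvg n fun z => A.pr id (boolPair (unaryEncodeNat n) (glFun f z)) {glPred z}

/-- The success probability at level `n = m + (m + par)` as a double sum over `(x, r)`. [folklore] -/
theorem predProb_eq (f : List Bool → List Bool) (A : RandAlg (List Bool) Bool) {par : ℕ} (hpar : par ≤ 1) (m : ℕ) :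
    predProb f A (nn par m) = (∑ x : List.Vector Bool m, ∑ r : List.Vector Bool (m + par),
      A.pr id (boolPair (unaryEncodeNat (nn par m)) (f x.toList ++ r.toList)) {ipBit x.toList r.toList}) /
        (2 ^ m * 2 ^ (m + par)) := by
  unfold predProb nn
  set φ : List Bool → List Bool → ℝ := fun u w => A.pr id (boolPair (unaryEncodeNat (m + (m + par))) (f u ++ w)) {ipBit u w}
    with hφ
  have hcongr : uniformAvg (m + (m + par)) (fun z => A.pr id (boolPair (unaryEncodeNat (m + (m + par))) (glFun f z)) {glPred z}) =
      uniformAvg (m + (m + par)) (fun z => φ (z.take m) (z.drop m)) := by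
    refine uniformAvg_congr fun z hz => ?_
    have hhalf : z.length / 2 = m := by rw [hz]; omega
    simp only [hφ, glFun, glPred_eq_ipBit, hhalf]
  rw [hcongr, uniformAvg_add m (m + par) φ]
  simp only [hφ, uniformAvg]
  rw [← Finset.sum_div, div_div, mul_comm]

variable (f : List Bool → List Bool)

/-- **`Pr[D_par(1ᵐ, real) = 1] = 1 − Pr[A predicts at level m + (m + par)]`** (for `m ≥ 4`,
`f` length-preserving): on the real sample `f(x) ‖ σ ‖ GL(x, σ)` the predictor sees
`(f(x), σ ↾ (m + par))` and is compared with `GL(x, σ)₀ = ⟨x, σ₀⟩`. [Goldreich 2001, §2.5.2] [folklore] -/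
theorem acceptPMF_real (hl : IsLengthPreserving f) (hpar : par ≤ 1) {m : ℕ} (hm : 4 ≤ m) :
    (acceptPMF (dAlg A par) m (glRealEns f S₀ (fun _ => 0) 1 m) true).toReal = 1 - predProb f A (nn par m) := by
  have hK2 : 2 ≤ Nat.log 2 m := Nat.le_log_of_pow_le (by norm_num) (by simpa using hm)
  have hK1 : 1 ≤ Nat.log 2 m := le_trans (by norm_num) hK2
  have hle : m + par ≤ Nat.log 2 m * m := by nlinarith
  have hne : (blockSeeds S₀ (Nat.log 2 m * m) m).Nonempty := blockSeeds_nonempty_iff.2 (S₀_nonempty m)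
  simp only [glRealEns, one_mul, zero_add]
  rw [toReal_acceptPMF_condUniform_map _ _ hne, card_blockSeeds, card_S₀, GLEns.sum_blockSeeds]
  -- pointwise
  have hpt : ∀ (x : List.Vector Bool m) (τ : List.Vector Bool (Nat.log 2 m * m)),
      (dAlg A par).pr id (boolPair (unaryEncodeNat m) (glReal f 0 (Nat.log 2 m) m (x.toList ++ τ.toList))) {true} =
        1 - A.pr id (boolPair (unaryEncodeNat (nn par m)) (f x.toList ++ τ.toList.take (m + par)))
          {ipBit x.toList (τ.toList.take (m + par))} := by
    intro x τ
    have hseed := glReal_seed f x (List.Vector.nil : List.Vector Bool 0) τ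
    simp only [List.Vector.toList_nil, List.append_nil] at hseed
    rw [hseed]
    have hfx : (f x.toList).length = m := by rw [hl, x.toList_length]
    have hστ : (f x.toList ++ τ.toList).length = m + Nat.log 2 m * m := by
      rw [List.length_append, hfx, τ.toList_length]
    have htake : (f x.toList ++ τ.toList ++ glBits (Nat.log 2 m) m x.toList τ.toList).take (nn par m) =
        f x.toList ++ τ.toList.take (m + par) := by
      rw [List.append_assoc, List.take_append, List.take_of_length_le (by rw [hfx]; unfold nn; omega), hfx,
        show nn par m - m = m + par by unfold nn; omega, List.take_append_of_le_length (by rw [τ.toList_length]; exact hle)]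
    have hdrop : ((f x.toList ++ τ.toList ++ glBits (Nat.log 2 m) m x.toList τ.toList).drop (m + Nat.log 2 m * m)).headD false =
        ipBit x.toList (τ.toList.take (m + par)) := by
      have hip : ipBit x.toList (τ.toList.take (m + par)) = ipBit x.toList (τ.toList.take m) := by
        rw [← ipBit_take_length, List.take_take, x.toList_length, min_eq_left (Nat.le_add_right m par)]
      rw [List.drop_left' hστ, headD_glBits hK1, hip]
    refine pr_dAlg_true (fun c => ?_) ?_
    · show dRun A par _ c = _
      simp only [dRun, boolUnpair_boolPair, length_unaryEncodeNat, htake, hdrop]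
    · show dCoin A par _ = _
      rw [dCoin, length_boolPair, length_unaryEncodeNat, List.length_append, hστ, length_glBits,
        show 2 * m + 2 + (m + Nat.log 2 m * m + Nat.log 2 m) = Ltot m from rfl, lvl_Ltot, length_boolPair, length_unaryEncodeNat,
        List.length_append, hfx, List.length_take, τ.toList_length, min_eq_left hle]
      unfold nn; ring_nf
  simp only [S₀]
  rw [Finset.sum_congr rfl fun x _ => Finset.sum_congr rfl fun τ _ => hpt x τ]
  -- sums
  simp only [Finset.sum_sub_distrib, Finset.sum_const, Finset.card_univ, card_vector, Fintype.card_bool, nsmul_eq_mul,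
    Nat.cast_pow, Nat.cast_ofNat, mul_one]
  have hsum : ∀ x : List.Vector Bool m, ∑ τ : List.Vector Bool (Nat.log 2 m * m),
      A.pr id (boolPair (unaryEncodeNat (nn par m)) (f x.toList ++ τ.toList.take (m + par))) {ipBit x.toList (τ.toList.take (m + par))} =
        2 ^ (Nat.log 2 m * m - (m + par)) * ∑ r : List.Vector Bool (m + par),
          A.pr id (boolPair (unaryEncodeNat (nn par m)) (f x.toList ++ r.toList)) {ipBit x.toList r.toList} :=
    fun x => sum_vector_take hle (fun r => A.pr id (boolPair (unaryEncodeNat (nn par m)) (f x.toList ++ r)) {ipBit x.toList r})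
  simp only [hsum, ← Finset.mul_sum]
  rw [predProb_eq f A hpar m]
  obtain ⟨b, hb⟩ := Nat.exists_eq_add_of_le hle
  rw [hb, Nat.add_sub_cancel_left]
  push_cast
  rw [pow_add]
  have h2 : (0 : ℝ) < 2 ^ m := by positivity
  have h3 : (0 : ℝ) < 2 ^ (m + par) := by positivity
  have h4 : (0 : ℝ) < 2 ^ b := by positivity
  field_simp

/-- **`Pr[D_par(1ᵐ, ideal) = 1] = 1/2`** (for `m ≥ 4`, `f` length-preserving): on the ideal sample
`f(x) ‖ σ ‖ u` the predictor's answer is compared with the fresh uniform bit `u₀`. [Goldreich 2001,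
§3.3.5] [folklore] -/
theorem acceptPMF_ideal (hl : IsLengthPreserving f) (hpar : par ≤ 1) {m : ℕ} (hm : 4 ≤ m) :
    (acceptPMF (dAlg A par) m (glIdealEns f S₀ (fun _ => 0) 1 m) true).toReal = 1 / 2 := by
  have hK2 : 2 ≤ Nat.log 2 m := Nat.le_log_of_pow_le (by norm_num) (by simpa using hm)
  have hK1 : 1 ≤ Nat.log 2 m := le_trans (by norm_num) hK2
  have hle : m + par ≤ Nat.log 2 m * m := by nlinarith
  have hne : (blockSeeds S₀ (Nat.log 2 m * m + Nat.log 2 m) m).Nonempty := blockSeeds_nonempty_iff.2 (S₀_nonempty m)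
  simp only [glIdealEns, one_mul, zero_add]
  rw [toReal_acceptPMF_condUniform_map _ _ hne, card_blockSeeds, card_S₀, GLEns.sum_blockSeeds]
  have hpt : ∀ (x : List.Vector Bool m) (τ : List.Vector Bool (Nat.log 2 m * m + Nat.log 2 m)),
      (dAlg A par).pr id (boolPair (unaryEncodeNat m) (glIdeal f 0 m (x.toList ++ τ.toList))) {true} =
        1 - A.pr id (boolPair (unaryEncodeNat (nn par m)) (f x.toList ++ τ.toList.take (m + par)))
          {(τ.toList.drop (Nat.log 2 m * m)).headD false} := by
    intro x τ
    have hseed := glIdeal_seed f x (List.Vector.nil : List.Vector Bool 0) τ.toList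
    simp only [List.Vector.toList_nil, List.append_nil] at hseed
    rw [hseed]
    have hfx : (f x.toList).length = m := by rw [hl, x.toList_length]
    have htake : (f x.toList ++ τ.toList).take (nn par m) = f x.toList ++ τ.toList.take (m + par) := by
      rw [List.take_append, List.take_of_length_le (by rw [hfx]; unfold nn; omega), hfx,
        show nn par m - m = m + par by unfold nn; omega]
    have hdrop : (f x.toList ++ τ.toList).drop (m + Nat.log 2 m * m) = τ.toList.drop (Nat.log 2 m * m) := by
      rw [List.drop_append, List.drop_of_length_le (by rw [hfx]; omega), hfx, List.nil_append,
        Nat.add_sub_cancel_left]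
    refine pr_dAlg_true (fun c => ?_) ?_
    · show dRun A par _ c = _
      simp only [dRun, boolUnpair_boolPair, length_unaryEncodeNat, htake, hdrop]
    · show dCoin A par _ = _
      rw [dCoin, length_boolPair, length_unaryEncodeNat, List.length_append, hfx, τ.toList_length,
        show 2 * m + 2 + (m + (Nat.log 2 m * m + Nat.log 2 m)) = Ltot m by unfold Ltot; ring, lvl_Ltot, length_boolPair,
        length_unaryEncodeNat, List.length_append, hfx, List.length_take, τ.toList_length,
        min_eq_left (le_trans hle (Nat.le_add_right _ _))]
      unfold nn; ring_nf
  simp only [S₀]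
  rw [Finset.sum_congr rfl fun x _ => Finset.sum_congr rfl fun τ _ => hpt x τ]
  -- split `τ = σ ‖ v`
  have hsplit : ∀ x : List.Vector Bool m, ∑ τ : List.Vector Bool (Nat.log 2 m * m + Nat.log 2 m),
      (1 - A.pr id (boolPair (unaryEncodeNat (nn par m)) (f x.toList ++ τ.toList.take (m + par)))
        {(τ.toList.drop (Nat.log 2 m * m)).headD false}) = 2 ^ (Nat.log 2 m * m) * 2 ^ (Nat.log 2 m - 1) := by
    intro x
    have e : ∀ l : List Bool, l.take (m + par) = (l.take (Nat.log 2 m * m)).take (m + par) := fun l => by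
      rw [List.take_take, min_eq_left hle]
    have hs := sum_vector_add (M := ℝ) (Nat.log 2 m * m) (Nat.log 2 m) (fun σ v =>
      1 - A.pr id (boolPair (unaryEncodeNat (nn par m)) (f x.toList ++ σ.take (m + par))) {v.headD false})
    rw [Finset.sum_congr rfl fun τ _ => by rw [e τ.toList], hs]
    -- inner sum over `v`
    obtain ⟨K', hK'⟩ := Nat.exists_eq_add_of_le' hK1
    have hinner : ∀ σ : List.Vector Bool (Nat.log 2 m * m), ∑ v : List.Vector Bool (Nat.log 2 m),
        (1 - A.pr id (boolPair (unaryEncodeNat (nn par m)) (f x.toList ++ σ.toList.take (m + par))) {v.toList.headD false}) =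
          2 ^ (Nat.log 2 m - 1) := by
      intro σ
      rw [sum_vector_cast (show Nat.log 2 m = 1 + K' by omega) (fun l =>
        1 - A.pr id (boolPair (unaryEncodeNat (nn par m)) (f x.toList ++ σ.toList.take (m + par))) {l.headD false})]
      have hs1 := sum_vector_add (M := ℝ) 1 K' (fun u _ =>
        1 - A.pr id (boolPair (unaryEncodeNat (nn par m)) (f x.toList ++ σ.toList.take (m + par))) {u.headD false})
      simp only [headD_take_one] at hs1
      rw [hs1]
      simp only [Finset.sum_const, Finset.card_univ, card_vector, Fintype.card_bool, nsmul_eq_mul, Nat.cast_pow, Nat.cast_ofNat]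
      rw [← Finset.mul_sum, sum_vector_one (fun b =>
        1 - A.pr id (boolPair (unaryEncodeNat (nn par m)) (f x.toList ++ σ.toList.take (m + par))) {b})]
      have hpr := pr_true_add_pr_false A (boolPair (unaryEncodeNat (nn par m)) (f x.toList ++ σ.toList.take (m + par)))
      rw [show K' = Nat.log 2 m - 1 by omega]
      generalize A.pr id (boolPair (unaryEncodeNat (nn par m)) (f x.toList ++ σ.toList.take (m + par))) {true} = P at hpr ⊢
      generalize A.pr id (boolPair (unaryEncodeNat (nn par m)) (f x.toList ++ σ.toList.take (m + par))) {false} = Q at hpr ⊢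
      rw [show (1 - P) + (1 - Q) = 1 by linarith, mul_one]
    simp only [hinner, Finset.sum_const, Finset.card_univ, card_vector, Fintype.card_bool, nsmul_eq_mul, Nat.cast_pow, Nat.cast_ofNat]
  simp only [hsplit, Finset.sum_const, Finset.card_univ, card_vector, Fintype.card_bool, nsmul_eq_mul, Nat.cast_pow, Nat.cast_ofNat]
  obtain ⟨K', hK'⟩ := Nat.exists_eq_add_of_le' hK1
  rw [hK', Nat.add_sub_cancel]
  push_cast
  rw [pow_add, pow_add, pow_one]
  have h2 : (0 : ℝ) < 2 ^ m := by positivity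
  have h3 : (0 : ℝ) < 2 ^ (K' * m) := by positivity
  have h4 : (0 : ℝ) < 2 ^ K' := by positivity
  field_simp

/-- **The distinguishing advantage of `D_par` is the predictor's advantage** at level
`m + (m + par)` (for `m ≥ 4`). [Goldreich 2001, §2.5.2, §3.3.5] [folklore] -/
theorem distAdvantage_dAlg (hl : IsLengthPreserving f) (hpar : par ≤ 1) {m : ℕ} (hm : 4 ≤ m) :
    distAdvantage (dAlg A par) (glRealEns f S₀ (fun _ => 0) 1) (glIdealEns f S₀ (fun _ => 0) 1) m =
      |predProb f A (nn par m) - 2⁻¹| := by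
  unfold distAdvantage
  rw [acceptPMF_real f hl hpar hm, acceptPMF_ideal f hl hpar hm,
    show (1 : ℝ) - predProb f A (nn par m) - 1 / 2 = -(predProb f A (nn par m) - 2⁻¹) by ring, abs_neg]

/-! ### Hiding from one-wayness, and the assembly -/

/-- **Recovering `x` is harder than inverting**: `hidingProb f 𝒜 S₀ 0 m ≤ invertProb f 𝒜 m`
(`{z | z = x} ⊆ f⁻¹(f x)`). [Liu–Pass 2020, Appendix (S-hiding versus one-way)] [folklore] -/
theorem hidingProb_le_invertProb (B : RandAlg (List Bool) (List Bool)) (m : ℕ) :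
    hidingProb f B S₀ (fun _ => 0) m ≤ invertProb f B m := by
  unfold hidingProb invertProb uniformAvg
  have hρ : ∀ ρ : List.Vector Bool 0, ρ.toList = [] := fun ρ => List.eq_nil_of_length_eq_zero ρ.toList_length
  simp only [S₀, hρ, List.append_nil, Finset.sum_const, Finset.card_univ, card_vector, Fintype.card_bool, pow_zero,
    one_smul, Nat.cast_pow, Nat.cast_ofNat, mul_one]
  refine div_le_div_of_nonneg_right (Finset.sum_le_sum fun x _ => ?_) (by positivity)
  -- monotonicity of `RandAlg.pr` in the event (`RandAlg.pr_mono` of `SIS.lean`, not imported here)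
  unfold RandAlg.pr
  refine ENNReal.toReal_mono (ne_top_of_le_ne_top ENNReal.one_ne_top ?_) ((B.outputPMF id _).toOuterMeasure.mono fun z hz => ?_)
  · calc (B.outputPMF id (boolPair (unaryEncodeNat m) (f x.toList))).toOuterMeasure {z | f z = f x.toList}
        ≤ (B.outputPMF id (boolPair (unaryEncodeNat m) (f x.toList))).toOuterMeasure Set.univ :=
          (B.outputPMF id _).toOuterMeasure.mono (Set.subset_univ _)
      _ = 1 := (PMF.toOuterMeasure_apply_eq_one_iff _ _).2 (Set.subset_univ _)
  · simp only [Set.mem_setOf_eq] at hz ⊢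
    rw [hz]

/-- **`f` is `S₀`-hiding** (with no randomness) when it is one-way. [folklore] -/
theorem isHidingOver_of_isOneWay (hf : IsOneWay f) : IsHidingOver f S₀ (fun _ => 0) := fun B hB =>
  (hf.2 B hB).trans_abs_le fun m => by
    rw [abs_of_nonneg (hidingProb_nonneg _ _ _ _ _), abs_of_nonneg (invertProb_nonneg _ _ _)]
    exact hidingProb_le_invertProb f B m

/-- A length-preserving `f` has seed length `ℓ_g(m) = m` on `S₀` (no randomness). [folklore] -/
theorem hasSeedLength_of_isLengthPreserving (hl : IsLengthPreserving f) : HasSeedLength f S₀ (fun _ => 0) (fun m => m) := by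
  intro n x ρ _ hρ
  rw [List.eq_nil_of_length_eq_zero hρ, List.append_nil, hl, x.toList_length]

/-- A property holding for infinitely many `n` holds for infinitely many `n` of one parity. [folklore] -/
theorem frequently_even_or_odd {p : ℕ → Prop} (h : ∃ᶠ n in atTop, p n) :
    (∃ᶠ m in atTop, p (nn 0 m)) ∨ (∃ᶠ m in atTop, p (nn 1 m)) := by
  by_contra hc
  rw [not_or, Filter.not_frequently, Filter.not_frequently] at hc
  obtain ⟨N, hN⟩ := eventually_atTop.1 (hc.1.and hc.2)
  obtain ⟨n, hn, hpn⟩ := Filter.frequently_atTop.1 h (2 * N)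
  obtain ⟨h0, h1⟩ := hN (n / 2) (by omega)
  rcases Nat.even_or_odd n with ⟨k, hk⟩ | ⟨k, hk⟩
  · exact h0 (by rwa [show nn 0 (n / 2) = n by unfold nn; omega])
  · exact h1 (by rwa [show nn 1 (n / 2) = n by unfold nn; omega])

variable {f}

/-- **No parity class carries a non-negligible advantage**: if the Goldreich–Levin ensembles of
`f` over `S₀` are indistinguishable, the predictor's advantage at the levels `m + (m + par)` is
eventually below `1/n^c`. [Goldreich 2001, §2.5.2] [folklore] -/
theorem not_frequently_of_indist (hl : IsLengthPreserving f) (hA : IsPPT A encodeBool) (hpar : par ≤ 1)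
    (hind : IsCompIndistinguishable (glRealEns f S₀ (fun _ => 0) 1) (glIdealEns f S₀ (fun _ => 0) 1)) (c : ℕ) :
    ¬ ∃ᶠ m in atTop, 1 / ((nn par m : ℕ) : ℝ) ^ c ≤ |predProb f A (nn par m) - 2⁻¹| := by
  have hdec := hind (dAlg A par) (dAlg_isPPT hA)
  have hev : ∀ᶠ m : ℕ in atTop, distAdvantage (dAlg A par) (glRealEns f S₀ (fun _ => 0) 1) (glIdealEns f S₀ (fun _ => 0) 1) m <
      1 / (m : ℝ) ^ (c + 1) :=
    (isNegligible_iff_eventually_lt_of_nonneg (fun m => distAdvantage_nonneg _ _ _ m)).1 hdec (c + 1)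
  rw [Filter.not_frequently]
  filter_upwards [hev, eventually_ge_atTop (max 4 (3 ^ c))] with m h1 h2
  rw [not_le]
  have hm4 : 4 ≤ m := le_of_max_le_left h2
  have hm3 : 3 ^ c ≤ m := le_of_max_le_right h2
  have hmR : (0 : ℝ) < m := by exact_mod_cast (show 0 < m by omega)
  have hnn : (0 : ℝ) < ((nn par m : ℕ) : ℝ) := by exact_mod_cast (show 0 < nn par m by unfold nn; omega)
  have hnn3 : ((nn par m : ℕ) : ℝ) ≤ 3 * m := by
    have : nn par m ≤ 3 * m := by unfold nn; omega
    exact_mod_cast this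
  rw [distAdvantage_dAlg f hl hpar hm4] at h1
  calc |predProb f A (nn par m) - 2⁻¹| < 1 / (m : ℝ) ^ (c + 1) := h1
    _ ≤ 1 / ((3 : ℝ) ^ c * (m : ℝ) ^ c) := by
        apply one_div_le_one_div_of_le (by positivity)
        rw [pow_succ']
        exact mul_le_mul_of_nonneg_right (by exact_mod_cast hm3) (by positivity)
    _ ≤ 1 / ((nn par m : ℕ) : ℝ) ^ c := by
        apply one_div_le_one_div_of_le (pow_pos hnn c)
        rw [← mul_pow]
        exact pow_le_pow_left₀ hnn.le hnn3 c

end GLHardCore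

open GLHardCore in
/-- **crypto-foundations.S24, the Goldreich–Levin theorem** (discharge of the named fact
`goldreich_levin`): for a length-preserving (strong) one-way `f`, the inner product mod 2
`b(x, r) = ⟨x, r⟩` is a hard-core predicate of `g(x, r) = (f(x), r)` — Goldreich 2001, Thm. 2.5.2
("Let `f` be an arbitrary strong one-way function, and let `g` be defined by `g(x, r) = (f(x), r)`,
where `|x| = |r|`. Let `b(x, r)` denote the inner product mod 2 of the binary vectors `x` and `r`.
Then the predicate `b` is a hard-core of the function `g`"), originally Goldreich–Levin, STOC 1989.

Proof (reduction to the tree's `O(log n)`-bit Goldreich–Levin theorem for hiding functions,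
`goldreichLevin_hiding_len_holds`, whose own proof is Rackoff's pairwise-independent list decoding run
as a PPT inverter): `b = glPred` is polynomial time (`polyTimeComputable_glPred`). A length-preserving
one-way `f` is `S₀`-hiding over `S₀ = {0,1}ᵐ` with no randomness (`isHidingOver_of_isOneWay`:
recovering `x` is harder than finding a preimage), so `{f(x) ‖ σ ‖ GL(x, σ)}` and `{f(x) ‖ σ ‖ U}`
(`|σ| = ⌊log₂ m⌋·m`) are computationally indistinguishable. If a PPT predictor `A` guessed
`b(U_n)` from `(1ⁿ, g(U_n))` with advantage `|ε(n)| ≥ 1/n^c` for infinitely many `n`, then for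
infinitely many `m` in one parity class `n = m + (m + par)` (`frequently_even_or_odd`), and the PPT
distinguisher `D_par` (`dAlg`: run `A` on `(f(x), σ ↾ (m + par))` and XOR with the first GL bit)
has advantage exactly `|ε(m + (m + par))|` at level `m` (`distAdvantage_dAlg`:
`Pr[D(real) = 1] = 1 − Pr[A correct]`, `Pr[D(ideal) = 1] = ½`), contradicting indistinguishability
(`not_frequently_of_indist`). [O. Goldreich, L. A. Levin, *A hard-core predicate for all one-way
functions*, STOC 1989, 25–32; O. Goldreich, *Foundations of Cryptography I*, CUP 2001, Thm. 2.5.2]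
[cite: GoldreichLevin1989] [cite: Goldreich2001, Thm. 2.5.2] -/
theorem goldreich_levin_holds : goldreich_levin := by
  intro f hf hl
  refine ⟨polyTimeComputable_glPred, fun A hA => ?_⟩
  by_contra hneg
  change ¬ SuperpolynomialDecay atTop (fun n : ℕ => (n : ℝ)) (fun n => predProb f A n - 2⁻¹) at hneg
  have habs : ¬ SuperpolynomialDecay atTop (fun n : ℕ => (n : ℝ)) (fun n => |predProb f A n - 2⁻¹|) := fun h =>
    hneg (h.trans_abs_le fun n => by rw [abs_abs])
  obtain ⟨c, hfreq⟩ := GLFin.exists_frequently_ge (fun n => abs_nonneg (predProb f A n - 2⁻¹)) habs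
  have hind := goldreichLevin_hiding_len_holds S₀ f (fun _ => 0) 1 (fun m => m)
    (hasSeedLength_of_isLengthPreserving f hl) (Eventually.of_forall S₀_nonempty) (isHidingOver_of_isOneWay f hf)
  rcases frequently_even_or_odd hfreq with h0 | h1
  · exact not_frequently_of_indist hl hA (Nat.zero_le 1) hind c h0
  · exact not_frequently_of_indist hl hA le_rfl hind c h1



end Literature.Computability.Cryptography
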